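import Summits.CriticalPhenomena.PercolationContinuityZ3.Theorems.PercNearOneGluingNoHeavyLowerTailCubicThreePointHqtInduction
import Summits.CriticalPhenomena.PercolationContinuityZ3.Theorems.PercNearOneGluingNoHeavyLowerTailCubicThreePointGluingMeasure
import Summits.CriticalPhenomena.PercolationContinuityZ3.Theorems.PercNearOneGluingNoHeavyLowerTailCubicThreePointFibreHqtCriterion
import Mathlib.Tactic.Ring
import Mathlib.Tactic.Linarith
import HarnessLib

/-!
# `H_{q+t} ≥ 0` on every finite weighted graph from the apex-edge pieces (BH1),(BH2) — part II: the step hypothesis RELATIVE TO THE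
# INDUCTIVE HYPOTHESIS, and the conditional theorems in the tree's `prodBernoulli` vocabulary

Support file (prover seat `prim-bnk-1`, gen 7; `--supports stmt-CriticalPhenomena-4575`).  Companion of `…CubicThreePointHqtInduction` (prim-facecert gen 3,
p205958: `StepHypH`, `step_apexH`, `hqt_of_stepHypH`; the twin file of this seat, p205990, was two minutes later and is superseded).  No named facts, no
sorries; one new hypothesis `StepHypHIH`.

WHY.  ttrl2 (cp-wf3b, run/shared/lean/ttrl/wf3lp/HQT-BH.md, 2026-08-20, FINAL for request 696) and prim-facecert gen 3 (FINDING-gen3-HQT-STEP-NO-ROW-CERTIFICATE):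
over the FULL proved Π4 row bank (two-set van den Berg–Häggström–Kahn conditional association with compound events, MIX, ccBK, Harris with unions, SHK, GLF,
Gladkov DT, hybrid 3PT-LB, T_inc, AG⁺) the pieces `hqtB₁`, `hqtB₂` admit EXACT pseudo-laws WITHOUT inductive-hypothesis rows (F = −6.37e-3 / −6.40e-3) and still
WITH the rows `H_{q+t} ≥ 0` on the four plain triples of `{a,b,c,m}` and on the `a = m` merge (F = −1.20e-3 / −1.41e-3, tight on the double-equality face
`H(x⁰) = H(x¹) = 0`) ⇒ no product-multiplier certificate over 15-cell rows at any degree; prim-l12-p2 gen 3: the missing first-order information lives on the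
attachment vertices (exact hidden-vertex identities).  So any proof of the pieces will use either the inductive hypothesis on the smaller edge set, or the
graph beyond the 15 cells, or both — `StepHypH` already quantifies over the graph `(D, K, p)`; this file adds the inductive hypothesis to the interface:
* `StepHypHIH V` — (BH1),(BH2) demanded only GIVEN `∀ K' a' b' c', 0 ≤ hqtW D p K' a' b' c'` on the SAME random-edge set `D` (in the `|D|`-induction: the
  inductive hypothesis on `D ∖ e`; it contains all of ttrl2's 'IH rows');  `stepHypHIH_of_stepHypH : StepHypH V → StepHypHIH V`;
* `step_apexHIH`, `hqtW_nonneg_of_stepHypHIH`, **`hqt_of_stepHypHIH : StepHypHIH V → ∀ D K p ∈ [0,1] a b c, 0 ≤ H_{q+t}(law)`** (same strong induction);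
* **`hqt_prodBernoulli_of_stepHypH`, `hqt_prodBernoulli_of_stepHypHIH`** — the conclusions as `0 ≤ Hqt (μ(a|b|c)) (μ(ab|c)) (μ(ac|b)) (μ(bc|a)) (μ(abc))`,
  `μ = prodBernoulli w` on any finite vertex type (bridge `TerminalGluing.real_cell*`), i.e. the all-`n` form of `hqt_le_five`.
-/

noncomputable section

namespace Summit.CriticalPhenomena.PercolationContinuityZ3.Theorems

namespace CubicThreePointStep

open Finset SimpleGraph Literature.Probability.Percolation.DecisionTree
open CubicThreePointTerminal TerminalEdgeStep TerminalGluing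

variable {V : Type*} [DecidableEq V]

/-- **(BH1),(BH2) RELATIVE TO THE INDUCTIVE HYPOTHESIS.**  As `StepHypH`, but the two inequalities are only demanded when `H_{q+t} ≥ 0` already
holds for the SAME random-edge set `D` with every forced set at every terminal triple — in the `|D|`-induction this is the inductive hypothesis on
`D ∖ e` (it contains ttrl2's 'IH rows': `H_{q+t} ≥ 0` on the four plain triples of `{a,b,c,m}` and on the `a = m` merge `K ∪ {e}`). [this work] -/
def StepHypHIH (V : Type*) [DecidableEq V] : Prop :=
  ∀ (D K : Finset (Sym2 V)) (p : Sym2 V → ℝ), (∀ i, 0 ≤ p i) → (∀ i, p i ≤ 1) →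
    (∀ (K' : Finset (Sym2 V)) (a' b' c' : V), 0 ≤ hqtW D p K' a' b' c') →
    ∀ (a b c x m : V), x ≠ m → (∀ S : Finset (Sym2 V), R K S a x) →
      0 ≤ hqtB₁ (PrW D p (evQ K a b c)) (PrW D p (evU₁ K a b c)) (PrW D p (evU₂ K a b c))
            (PrW D p (evU₃ K a b c)) (PrW D p (evT K a b c))
            (PrW D p (evQ K a b c ∩ evU₁ (insert s(x, m) K) a b c))
            (PrW D p (evQ K a b c ∩ evU₂ (insert s(x, m) K) a b c))
            (PrW D p (evU₁ K a b c ∩ evT (insert s(x, m) K) a b c))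
            (PrW D p (evU₂ K a b c ∩ evT (insert s(x, m) K) a b c))
            (PrW D p (evU₃ K a b c ∩ evT (insert s(x, m) K) a b c)) ∧
        0 ≤ hqtB₂ (PrW D p (evQ K a b c)) (PrW D p (evU₁ K a b c)) (PrW D p (evU₂ K a b c))
            (PrW D p (evU₃ K a b c)) (PrW D p (evT K a b c))
            (PrW D p (evQ K a b c ∩ evU₁ (insert s(x, m) K) a b c))
            (PrW D p (evQ K a b c ∩ evU₂ (insert s(x, m) K) a b c))
            (PrW D p (evU₁ K a b c ∩ evT (insert s(x, m) K) a b c))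
            (PrW D p (evU₂ K a b c ∩ evT (insert s(x, m) K) a b c))
            (PrW D p (evU₃ K a b c ∩ evT (insert s(x, m) K) a b c))

/-- The IH-free step hypothesis implies the IH-relative one. [this work] -/
theorem stepHypHIH_of_stepHypH (h : StepHypH V) : StepHypHIH V :=
  fun D K p hp0 hp1 _ a b c x m hxm hax => h D K p hp0 hp1 a b c x m hxm hax

/-- Bridge between the two tree copies of the weighted `H_{q+t}` row: `CubicThreePointStep.hqtW` (the copy this file's
statements denote since the 11:36Z re-landing of `…CubicThreePointHqtInduction`) and `TerminalGluing.hqtW` of the fibre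
criterion (the copy the 10:27Z landing of this module elaborated against; identical bodies).  Stated as a congruence and
proved by the generated congruence lemma of `TerminalGluing.hqtW`, so that this module keeps providing
`TerminalGluing.hqtW.congr_simp` exactly as its accepted build did. [this work] -/
theorem hqtW_congr_terminalGluing {D D' : Finset (Sym2 V)} (hD : D = D') (p : Sym2 V → ℝ) (K : Finset (Sym2 V))
    (a b c : V) : hqtW D p K a b c = TerminalGluing.hqtW D' p K a b c :=
  TerminalGluing.hqtW.congr_simp D D' hD p p rfl K K rfl a a rfl b b rfl c c rfl

section InductionIH
variable {p : Sym2 V → ℝ} (hp0 : ∀ i, 0 ≤ p i) (hp1 : ∀ i, p i ≤ 1)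
include hp0 hp1

/-- **The apex step with the inductive hypothesis passed to the pieces.**  If `e = {x,m} ∈ D`, `x ≠ m`, `x` is forced-joined to `a`, `H_{q+t} ≥ 0` holds for
`D ∖ e` with EVERY forced set at EVERY terminal triple, and (BH1),(BH2) hold given that, then `H_{q+t} ≥ 0` for `(D, K)`. [this work] -/
theorem step_apexHIH (hstep : StepHypHIH V) {D K : Finset (Sym2 V)} {a b c x m : V} (hxm : x ≠ m)
    (hax : ∀ S : Finset (Sym2 V), R K S a x) (he : s(x, m) ∈ D)
    (ih : ∀ (K' : Finset (Sym2 V)) (a' b' c' : V), 0 ≤ hqtW (D.erase s(x, m)) p K' a' b' c') :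
    0 ≤ hqtW D p K a b c := by
  have ih0 : 0 ≤ hqtW (D.erase s(x, m)) p K a b c := ih K a b c
  have ih1 : 0 ≤ hqtW (D.erase s(x, m)) p (insert s(x, m) K) a b c := ih _ a b c
  set e := s(x, m) with he_def
  set D' := D.erase e with hD'
  have heD' : e ∉ D' := Finset.notMem_erase e D
  have hD : D = insert e D' := (Finset.insert_erase he).symm
  have sq : PrW D p (evQ K a b c) = (1 - p e) * PrW D' p (evQ K a b c) + p e * PrW D' p (evQ (insert e K) a b c) := by
    rw [hD, PrW_split D' p heD', sect_evQ]
  have s1 : PrW D p (evU₁ K a b c) = (1 - p e) * PrW D' p (evU₁ K a b c) + p e * PrW D' p (evU₁ (insert e K) a b c) := by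
    rw [hD, PrW_split D' p heD', sect_evU₁]
  have s2 : PrW D p (evU₂ K a b c) = (1 - p e) * PrW D' p (evU₂ K a b c) + p e * PrW D' p (evU₂ (insert e K) a b c) := by
    rw [hD, PrW_split D' p heD', sect_evU₂]
  have s3 : PrW D p (evU₃ K a b c) = (1 - p e) * PrW D' p (evU₃ K a b c) + p e * PrW D' p (evU₃ (insert e K) a b c) := by
    rw [hD, PrW_split D' p heD', sect_evU₃]
  have sT : PrW D p (evT K a b c) = (1 - p e) * PrW D' p (evT K a b c) + p e * PrW D' p (evT (insert e K) a b c) := by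
    rw [hD, PrW_split D' p heD', sect_evT]
  have tQ := trans_Q D' p (K := K) (b := b) (c := c) (m := m) hax
  have t1 := trans_U₁ D' p (K := K) (a := a) (b := b) (c := c) (x := x) (m := m)
  have t2 := trans_U₂ D' p (K := K) (a := a) (b := b) (c := c) (x := x) (m := m)
  have t3 := trans_U₃ D' p (K := K) (b := b) (c := c) (m := m) hax
  have tT := trans_T D' p (K := K) (b := b) (c := c) (m := m) hax
  set q := PrW D' p (evQ K a b c)
  set u₁ := PrW D' p (evU₁ K a b c)
  set u₂ := PrW D' p (evU₂ K a b c)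
  set u₃ := PrW D' p (evU₃ K a b c)
  set t := PrW D' p (evT K a b c)
  set α₁ := PrW D' p (evQ K a b c ∩ evU₁ (insert e K) a b c)
  set α₂ := PrW D' p (evQ K a b c ∩ evU₂ (insert e K) a b c)
  set β₁ := PrW D' p (evU₁ K a b c ∩ evT (insert e K) a b c)
  set β₂ := PrW D' p (evU₂ K a b c ∩ evT (insert e K) a b c)
  set β₃ := PrW D' p (evU₃ K a b c ∩ evT (insert e K) a b c)
  have hq1 : PrW D' p (evQ (insert e K) a b c) = q - α₁ - α₂ := by linarith
  have hu1 : PrW D' p (evU₁ (insert e K) a b c) = u₁ + α₁ - β₁ := by linarith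
  have hu2 : PrW D' p (evU₂ (insert e K) a b c) = u₂ + α₂ - β₂ := by linarith
  have hu3 : PrW D' p (evU₃ (insert e K) a b c) = u₃ - β₃ := by linarith
  have ht1 : PrW D' p (evT (insert e K) a b c) = t + β₁ + β₂ + β₃ := by linarith
  obtain ⟨hB1, hB2⟩ := hstep D' K p hp0 hp1 (by simpa only [hD'] using ih) a b c x m hxm hax
  have h3 : 0 ≤ Hqt (q - α₁ - α₂) (u₁ + α₁ - β₁) (u₂ + α₂ - β₂) (u₃ - β₃) (t + β₁ + β₂ + β₃) := by
    have := ih1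
    unfold hqtW at this
    rwa [hq1, hu1, hu2, hu3, ht1] at this
  have h0 : 0 ≤ Hqt q u₁ u₂ u₃ t := ih0
  have key := Hqt_segment_nonneg_of_bernstein h0 h3 hB1 hB2 (hp0 e) (hp1 e)
  unfold hqtW
  rw [sq, s1, s2, s3, sT, hq1, hu1, hu2, hu3, ht1]
  have e1 : (1 - p e) * q + p e * (q - α₁ - α₂) = q + p e * (-α₁ - α₂) := by ring
  have e2 : (1 - p e) * u₁ + p e * (u₁ + α₁ - β₁) = u₁ + p e * (α₁ - β₁) := by ring
  have e3 : (1 - p e) * u₂ + p e * (u₂ + α₂ - β₂) = u₂ + p e * (α₂ - β₂) := by ring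
  have e4 : (1 - p e) * u₃ + p e * (u₃ - β₃) = u₃ + p e * (-β₃) := by ring
  have e5 : (1 - p e) * t + p e * (t + β₁ + β₂ + β₃) = t + p e * (β₁ + β₂ + β₃) := by ring
  rw [e1, e2, e3, e4, e5]
  exact key

/-- **`H_{q+t} ≥ 0` for every finite weighted graph, from the IH-relative step hypothesis** (the same strong induction; the full inductive hypothesis on
`D ∖ e` is handed to `StepHypHIH` at each step). [this work] -/
theorem hqtW_nonneg_of_stepHypHIH (hstep : StepHypHIH V) :
    ∀ (n : ℕ) (D K : Finset (Sym2 V)) (a b c : V), D.card = n → 0 ≤ hqtW D p K a b c := by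
  intro n
  induction n using Nat.strong_induction_on with
  | _ n ih =>
  intro D K a b c hDn
  by_cases hex : ∃ e ∈ D, ∃ y z : V, e = s(y, z) ∧ y ≠ z ∧ (R K ∅ a y ∨ R K ∅ b y ∨ R K ∅ c y)
  · obtain ⟨e, heD, y, z, rfl, hyz, hreach⟩ := hex
    have hlt : (D.erase s(y, z)).card < n := by rw [← hDn]; exact Finset.card_erase_lt_of_mem heD
    have IH : ∀ (K' : Finset (Sym2 V)) (a' b' c' : V), 0 ≤ hqtW (D.erase s(y, z)) p K' a' b' c' :=
      fun K' a' b' c' => ih _ hlt _ K' a' b' c' rfl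
    rcases hreach with h | h | h
    · exact step_apexHIH hp0 hp1 hstep hyz (fun S => R_mono_config (Finset.empty_subset S) h) heD IH
    · rw [← hqtW_swap12]
      exact step_apexHIH hp0 hp1 hstep hyz (fun S => R_mono_config (Finset.empty_subset S) h) heD IH
    · rw [← hqtW_swap13]
      exact step_apexHIH hp0 hp1 hstep hyz (fun S => R_mono_config (Finset.empty_subset S) h) heD IH
  · push Not at hex
    have ha : ∀ e ∈ D, ∀ y z : V, e = s(y, z) → y ≠ z → ¬ R K ∅ a y :=
      fun e he y z hyz hne => (hex e he y z hyz hne).1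
    have hb : ∀ e ∈ D, ∀ y z : V, e = s(y, z) → y ≠ z → ¬ R K ∅ b y :=
      fun e he y z hyz hne => (hex e he y z hyz hne).2.1
    rw [hqtW_eq_zero_of_frozen D p K a b c ha hb]

/-- **`H_{q+t} ≥ 0` on every finite weighted graph CONDITIONAL on the IH-relative apex inequalities `StepHypHIH`** (the form a with-IH
theorem-rows certificate for (BH1),(BH2) would discharge). [this work] -/
theorem hqt_of_stepHypHIH (hstep : StepHypHIH V) (D K : Finset (Sym2 V)) (a b c : V) :
    0 ≤ Hqt (PrW D p (evQ K a b c)) (PrW D p (evU₁ K a b c)) (PrW D p (evU₂ K a b c)) (PrW D p (evU₃ K a b c))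
      (PrW D p (evT K a b c)) :=
  hqtW_nonneg_of_stepHypHIH hp0 hp1 hstep D.card D K a b c rfl

end InductionIH


section Measure
variable [Fintype V]
open MeasureTheory Literature.Probability.Percolation Literature.Probability.LatticeModels TerminalGluing

/-- **`H_{q+t} ≥ 0` under `prodBernoulli w` on EVERY finite weighted graph, conditional on (BH1),(BH2)** (`StepHypH`): with
`q = μ(a|b|c)`, `u₁ = μ(ab|c)`, `u₂ = μ(ac|b)`, `u₃ = μ(bc|a)`, `t = μ(abc)`: `0 ≤ (q+t)(q t − e₂(u)) − e₃(u)` — the all-`n` form of `hqt_le_five` (bridge `TerminalGluing.real_cell*`). [this work] -/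
theorem hqt_prodBernoulli_of_stepHypH (h : StepHypH V) (w : Sym2 V → unitInterval) (a b c : V) :
    0 ≤ Hqt ((prodBernoulli w).real ((openConn a b)ᶜ ∩ (openConn a c)ᶜ ∩ (openConn b c)ᶜ))
      ((prodBernoulli w).real (openConn a b ∩ (openConn a c)ᶜ)) ((prodBernoulli w).real (openConn a c ∩ (openConn a b)ᶜ))
      ((prodBernoulli w).real (openConn b c ∩ (openConn a b)ᶜ)) ((prodBernoulli w).real (openConn a b ∩ openConn a c)) := by
  rw [real_cellQ, real_cellU₁, real_cellU₂, real_cellU₃, real_cellT]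
  exact hqt_of_stepHypH (fun e => (w e).2.1) (fun e => (w e).2.2) h _ _ a b c

/-- **The same from the IH-relative hypothesis `StepHypHIH`.** [this work] -/
theorem hqt_prodBernoulli_of_stepHypHIH (h : StepHypHIH V) (w : Sym2 V → unitInterval) (a b c : V) :
    0 ≤ Hqt ((prodBernoulli w).real ((openConn a b)ᶜ ∩ (openConn a c)ᶜ ∩ (openConn b c)ᶜ))
      ((prodBernoulli w).real (openConn a b ∩ (openConn a c)ᶜ)) ((prodBernoulli w).real (openConn a c ∩ (openConn a b)ᶜ))
      ((prodBernoulli w).real (openConn b c ∩ (openConn a b)ᶜ)) ((prodBernoulli w).real (openConn a b ∩ openConn a c)) := by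
  rw [real_cellQ, real_cellU₁, real_cellU₂, real_cellU₃, real_cellT]
  exact hqt_of_stepHypHIH (fun e => (w e).2.1) (fun e => (w e).2.2) h _ _ a b c

end Measure

end CubicThreePointStep

end Summit.CriticalPhenomena.PercolationContinuityZ3.Theorems

end
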